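import Summits.AtomisticToContinuum.HydrodynamicLimit.Theses.AntiMazurCoboundaries
import Summits.AtomisticToContinuum.HydrodynamicLimit.Theses.FluxGibbsianityLdDrude
import Summits.AtomisticToContinuum.HydrodynamicLimit.Theses.TwoClocks
import Summits.AtomisticToContinuum.HydrodynamicLimit.Theses.OneFlightGossipEngine
import Summits.AtomisticToContinuum.HydrodynamicLimit.Theorems.ImplosionDichotomyHydroLimitInBandSignedInputs
import Summits.AtomisticToContinuum.HydrodynamicLimit.Theorems.ImplosionDichotomyHydroLimitProfilewiseBandKcwfQReduction
import Summits.AtomisticToContinuum.HydrodynamicLimit.Theorems.AntiMazurCoboundariesKineticWindowGronwallClockFromInstance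
import Summits.AtomisticToContinuum.HydrodynamicLimit.Theorems.AntiMazurCoboundariesKineticWindowGronwallSplit
import HarnessLib

/-!
# Crux `KineticWindowGronwall` (stmt-AtomisticToContinuum-9282) docked on the SIGNED-BAND heart: the crux from six board items
# (support file, `--supports stmt-AtomisticToContinuum-9282`; composition of line `board-node-dock`, skeleton v5)

Crux `Summit.AtomisticToContinuum.HydrodynamicLimit.Theses.AntiMazurCoboundaries.KineticWindowGronwall`
(`:= KineticFluxLdDecay → RelEntropyVanishing`; shared verbatim with route FluxGibbsianityLdDrude).

The heart's own lines re-threaded the one-window entropy clock on 2026-08-17 (crux 9133 lead c17, crux 17372 leads c7–c8) around the refuted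
coherence input `BandCoherenceLDAlongFamilies` (stmt-17700): signed band remainder, the suprathermal heat flux paid at a RATE by
`SuperExponentialEnergyTails` (SEET, stmt-17701), the kinetic input reduced to the class-uniform node KCWF-Q (stmt-18052). The landed chain
`HydroLimitInBandSignedBand.hydroLimitInBand_of_signedInputs` (p148646) passes through the guarded Grönwall core
`HydroLimitInBandOfHeart.GronwallCoreInBand`; lead c3 of THIS crux had already un-guarded that core into `RelEntropyVanishing` verbatim
(`KineticWindowGronwallClockFromInstance.relEntropyVanishing_of_gronwallCoreInBand`, with `DiluteSelfConsistency`). Composing the two: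

* `gronwallCoreInBand_of_signedItems` — the core from the five ITEMS SEET (17701), KCWF-Q (18052), LCTF (17691), EAT (17703), CAT (13734);
* `relEntropyVanishing_of_signedItems`, `kineticWindowGronwall_of_signedItems` (+ the FluxGibbsianityLdDrude twin) — the crux's consequent and
  the crux BY NAME from those five items and DSC (3091): the `--glue-by` declaration for a six-way split of stmt-9282 onto EXISTING items;
* `kcwfQ_of_child₁` — the bounds-uniform general-`F` node `KineticWindowGronwallSplit.KineticWindowLDBoundsUniform` (child 1 of the split requested
  on 2026-08-17T09:39Z) implies the item KCWF-Q (through crux 16659's stub shape `KCWUSharpPlus` and the landed `kcwfQ_of_kcwuSharpPlus`), so that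
  child STAYS sufficient; `kineticWindowGronwall_of_child₁` — the crux from child 1, SEET, LCTF, EAT, CAT, DSC: the weighted true-law coherence
  `CoherentSuprathermalContentVanishesW` (child 2 of that split; no board item) is no longer consumed, nor are TwoClocks 16624 / 9235.

HONESTY: the antecedent `KineticFluxLdDecay` is idle (it is implied by TwoClocks 14440, the constant-profile case of the kinetic node); `DiluteSelfConsistency`
is load-bearing because `RelEntropyVanishing` is the UNGUARDED Yau target. Quantifier plumbing over landed theorems only.
Lead prover-line-stmt-AtomisticToContinuum-9282-c7-0 (line `board-node-dock`, skeleton v5).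
-/

noncomputable section

open scoped BigOperators ENNReal Classical
open MeasureTheory Set

namespace Summit.AtomisticToContinuum.HydrodynamicLimit.Theorems.KineticWindowGronwallSignedDock

open Summit.AtomisticToContinuum.HydrodynamicLimit.Theses
open Summit.AtomisticToContinuum.HydrodynamicLimit.Theses.AntiMazurCoboundaries
  (KineticFluxLdDecay RelEntropyVanishing KineticWindowGronwall)
open Summit.AtomisticToContinuum.HydrodynamicLimit.Theses.TwoClocks (DiluteSelfConsistency)
open Summit.AtomisticToContinuum.HydrodynamicLimit.Theorems
open Summit.AtomisticToContinuum.HydrodynamicLimit.Theorems.HydroLimitInBandOfHeart (GronwallCoreInBand)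
open Literature.Analysis.FluidPDE Literature.MathematicalPhysics.KineticTheory

/-! ## §1 The crux from six board items -/

/-- **The guarded Grönwall core from the five signed inputs** — the `have`-chain of the landed
`HydroLimitInBandSignedBand.hydroLimitInBand_of_signedInputs` (crux 9133, lead c17) stopped one line early, with KCWF-Q read as the route
item stmt-18052 (`kcwfQ_iff_routeItem`). Quantifier plumbing over landed theorems only. [cite: Yau1991, §2] -/
theorem gronwallCoreInBand_of_signedItems (hS : OneFlightGossipEngine.SuperExponentialEnergyTails)
    (hQ : OneFlightGossipEngine.KineticCurrentsLDAlongFamiliesQ) (hL : OneFlightGossipEngine.LocalClampedTransferLDAlongFamilies)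
    (hE : OneFlightGossipEngine.EnergyActivityTails) (hC : OneFlightGossipEngine.CollisionActivityTails) : GronwallCoreInBand := by
  have hQ' : HydroLimitInBandSignedBand.KineticCurrentsLDAlongFamiliesQ := HydroLimitProfilewiseBandKcwfQ.kcwfQ_iff_routeItem.1 hQ
  have hK : HydroLimitInBandOfHeart.KineticCurrentsWindowLDFamily := HydroLimitInBandSignedBand.kcwf_of_kcwfQ hQ'
  have h₆ : OneFlightGossipEngine.EnergyCurrentTails := ClampedTransferDockSeet.seet_imp_energyCurrentTails hS
  have hOW := HydroLimitInBandWindowClauseS.stub_windowClauseRateS ClampedTransferDockRate.stub_windowEstimateRate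
    HydroLimitInBandCubicChannelS.stub_cubicChannelRateS HydroLimitInBandBandShift.stub_bandShiftStatics
    HydroLimitInBandKineticInstanceOrth.stub_kineticInstanceOrth hQ' hS hL hE hK hC h₆
  have hWC : ClampedCurrentsDockFromWindows.WindowContinuityInBand :=
    HydroLimitInBandContinuity.stub_windowContinuityInBand hC hE h₆
  exact ClampedTransferDockLedgerEndD.stub_ledgerEndD hOW hWC EntropyClockDock.ledgerAprioriBound

/-- **`RelEntropyVanishing` (the crux's consequent, = target stmt-0766 verbatim) from the six items**: the core un-guarded by
`DiluteSelfConsistency` (`KineticWindowGronwallClockFromInstance.relEntropyVanishing_of_gronwallCoreInBand`, lead c3, landed). [cite: Yau1991, §2] -/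
theorem relEntropyVanishing_of_signedItems (hS : OneFlightGossipEngine.SuperExponentialEnergyTails)
    (hQ : OneFlightGossipEngine.KineticCurrentsLDAlongFamiliesQ) (hL : OneFlightGossipEngine.LocalClampedTransferLDAlongFamilies)
    (hE : OneFlightGossipEngine.EnergyActivityTails) (hC : OneFlightGossipEngine.CollisionActivityTails) (hD : DiluteSelfConsistency) :
    RelEntropyVanishing :=
  KineticWindowGronwallClockFromInstance.relEntropyVanishing_of_gronwallCoreInBand (gronwallCoreInBand_of_signedItems hS hQ hL hE hC) hD

/-- **THE SIX-ITEM GLUE** (`--glue-by` decl): SEET → KCWF-Q → LCTF → EAT → CAT → DSC → `KineticWindowGronwall` (the item's primary decl, route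
FluxGibbsianityLdDrude; same term as AntiMazurCoboundaries'). The antecedent `KineticFluxLdDecay` is idle (module docstring). [cite: OllaVaradhanYau1993, §2–3] -/
theorem kineticWindowGronwall_of_signedItems :
    OneFlightGossipEngine.SuperExponentialEnergyTails → OneFlightGossipEngine.KineticCurrentsLDAlongFamiliesQ →
      OneFlightGossipEngine.LocalClampedTransferLDAlongFamilies → OneFlightGossipEngine.EnergyActivityTails →
      OneFlightGossipEngine.CollisionActivityTails → DiluteSelfConsistency →
      Summit.AtomisticToContinuum.HydrodynamicLimit.Theses.FluxGibbsianityLdDrude.KineticWindowGronwall :=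
  fun hS hQ hL hE hC hD _ => relEntropyVanishing_of_signedItems hS hQ hL hE hC hD

/-- The same glue for the sibling decl (route AntiMazurCoboundaries; same term). [folklore] -/
theorem kineticWindowGronwall_of_signedItems' :
    OneFlightGossipEngine.SuperExponentialEnergyTails → OneFlightGossipEngine.KineticCurrentsLDAlongFamiliesQ →
      OneFlightGossipEngine.LocalClampedTransferLDAlongFamilies → OneFlightGossipEngine.EnergyActivityTails →
      OneFlightGossipEngine.CollisionActivityTails → DiluteSelfConsistency →
      Summit.AtomisticToContinuum.HydrodynamicLimit.Theses.AntiMazurCoboundaries.KineticWindowGronwall :=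
  kineticWindowGronwall_of_signedItems

/-! ## §2 The split child 1 stays sufficient -/

/-- Joint continuity of the pointwise structured member `A(x):w⊗w + (b(x)·w) G(x,‖w‖²) + K(x,‖w‖²)`, `w = v − u₀(x)`. [folklore] -/
theorem continuous_classMember {A : T3 → Fin 3 → Fin 3 → ℝ} {b : T3 → V3} {G K : T3 × ℝ → ℝ} {u₀ : T3 → V3}
    (hA : Continuous A) (hb : Continuous b) (hG : Continuous G) (hK : Continuous K) (hu : Continuous u₀) :
    Continuous fun y : T3 × V3 =>
      (∑ j : Fin 3, ∑ k : Fin 3, A y.1 j k * ((y.2 - u₀ y.1) j * (y.2 - u₀ y.1) k)) +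
        (∑ j : Fin 3, b y.1 j * (y.2 - u₀ y.1) j) * G (y.1, ‖y.2 - u₀ y.1‖ ^ 2) + K (y.1, ‖y.2 - u₀ y.1‖ ^ 2) := by
  have hw : Continuous fun y : T3 × V3 => y.2 - u₀ y.1 := continuous_snd.sub (hu.comp continuous_fst)
  have hwj : ∀ j : Fin 3, Continuous fun y : T3 × V3 => (y.2 - u₀ y.1) j := fun j =>
    (PiLp.continuous_apply 2 _ j).comp hw
  have hAjk : ∀ j k : Fin 3, Continuous fun y : T3 × V3 => A y.1 j k := fun j k =>
    (continuous_apply k).comp ((continuous_apply j).comp (hA.comp continuous_fst))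
  have hbj : ∀ j : Fin 3, Continuous fun y : T3 × V3 => b y.1 j := fun j =>
    (PiLp.continuous_apply 2 _ j).comp (hb.comp continuous_fst)
  have hr : Continuous fun y : T3 × V3 => (y.1, ‖y.2 - u₀ y.1‖ ^ 2) := continuous_fst.prodMk (hw.norm.pow 2)
  refine ((continuous_finsetSum _ fun j _ => continuous_finsetSum _ fun k _ =>
    (hAjk j k).mul ((hwj j).mul (hwj k))).add
    ((continuous_finsetSum _ fun j _ => (hbj j).mul (hwj j)).mul (hG.comp hr))).add (hK.comp hr)

/-- **The v4/split child 1 feeds the new kinetic stub**: the bounds-uniform general-`F` node `KineticWindowLDBoundsUniform` gives the route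
item KCWF-Q (stmt-18052) — through crux 16659's registered stub shape `KCWUSharpPlus` (the structured class is a subclass of the continuous
quadratic-growth class; normalise `F` by `max C 1`, tilt radius `β₀ / max C 1`; the node's `η₀` is kept) and the landed
`HydroLimitProfilewiseBandKcwfQ.kcwfQ_of_kcwuSharpPlus`. So the already-requested split child 1 remains SUFFICIENT for `stub_kcwfQ`. [folklore] -/
theorem kcwfQ_of_child₁ (hU : KineticWindowGronwallSplit.KineticWindowLDBoundsUniform) :
    OneFlightGossipEngine.KineticCurrentsLDAlongFamiliesQ := by
  refine HydroLimitProfilewiseBandKcwfQ.kcwfQ_iff_routeItem.2 (HydroLimitProfilewiseBandKcwfQ.kcwfQ_of_kcwuSharpPlus ?_)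
  obtain ⟨η₀, hη₀, H⟩ := hU
  refine ⟨η₀, hη₀, fun Θ U C Λ hΘ hU0 hC0 hΛ σ hσ => ?_⟩
  have hΘ0 : 0 < Θ := by linarith
  have hΘinv : Θ⁻¹ ≤ Θ := (inv_le_one_of_one_le₀ hΘ).trans hΘ
  obtain ⟨β₀, hβ₀, Hβ⟩ := H Θ⁻¹ Θ U (inv_pos.2 hΘ0) hΘinv hU0 σ hσ
  set C' : ℝ := max C 1 with hC'def
  have hC'1 : 1 ≤ C' := le_max_right _ _
  have hC'0 : 0 < C' := by positivity
  have hCC' : C ≤ C' := le_max_left _ _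
  refine ⟨β₀ / C', div_pos hβ₀ hC'0, ?_⟩
  intro a θ₀ u₀ ha hθ hu haΛ hθΘ huU hguard Φ A b G K hA hb hG hK F hFdef hFC hO1 hO2 hO3 β hβ ε hε
  have hΛ0 : 0 < Λ := by linarith
  have ha0 : ∀ x, 0 < a x := fun x => (inv_pos.2 hΛ0).trans_le (haΛ x).1
  have hθm_le : ∀ x, Θ⁻¹ ≤ θ₀ x := fun x => (hθΘ x).1
  have hθM_ge : ∀ x, θ₀ x ≤ Θ := fun x => (hθΘ x).2
  -- the given member is continuous (it IS the structured formula)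
  have hFeq : F = fun y : T3 × V3 =>
      (∑ j : Fin 3, ∑ k : Fin 3, A y.1 j k * ((y.2 - u₀ y.1) j * (y.2 - u₀ y.1) k)) +
        (∑ j : Fin 3, b y.1 j * (y.2 - u₀ y.1) j) * G (y.1, ‖y.2 - u₀ y.1‖ ^ 2) + K (y.1, ‖y.2 - u₀ y.1‖ ^ 2) :=
    funext hFdef
  have hFc : Continuous F := by rw [hFeq]; exact continuous_classMember hA hb hG hK hu
  -- normalisation of the observable
  set F' : T3 × V3 → ℝ := fun y => C'⁻¹ * F y with hF'def
  have hF'c : Continuous F' := continuous_const.mul hFc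
  have hF'b : ∀ y, |F' y| ≤ 1 + ‖y.2‖ ^ 2 := by
    intro y
    simp only [hF'def, abs_mul, abs_inv, abs_of_pos hC'0]
    have h1 : |F y| ≤ C' * (1 + ‖y.2‖ ^ 2) := (hFC y).trans (mul_le_mul_of_nonneg_right hCC' (by positivity))
    calc C'⁻¹ * |F y| ≤ C'⁻¹ * (C' * (1 + ‖y.2‖ ^ 2)) := mul_le_mul_of_nonneg_left h1 (inv_nonneg.2 hC'0.le)
      _ = 1 + ‖y.2‖ ^ 2 := by field_simp
  have hO1' : ∀ x, ∫ v, F' (x, v) * localMaxwellian 1 (θ₀ x) (u₀ x) v = 0 := by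
    intro x
    have e : (fun v => F' (x, v) * localMaxwellian 1 (θ₀ x) (u₀ x) v) =
        fun v => C'⁻¹ * (F (x, v) * localMaxwellian 1 (θ₀ x) (u₀ x) v) := by
      funext v; simp only [hF'def]; ring
    rw [e, integral_const_mul, hO1 x, mul_zero]
  have hO2' : ∀ x (j : Fin 3), ∫ v, F' (x, v) * v j * localMaxwellian 1 (θ₀ x) (u₀ x) v = 0 := by
    intro x j
    have e : (fun v => F' (x, v) * v j * localMaxwellian 1 (θ₀ x) (u₀ x) v) =
        fun v => C'⁻¹ * (F (x, v) * v j * localMaxwellian 1 (θ₀ x) (u₀ x) v) := by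
      funext v; simp only [hF'def]; ring
    rw [e, integral_const_mul, hO2 x j, mul_zero]
  have hO3' : ∀ x, ∫ v, F' (x, v) * ‖v‖ ^ 2 * localMaxwellian 1 (θ₀ x) (u₀ x) v = 0 := by
    intro x
    have e : (fun v => F' (x, v) * ‖v‖ ^ 2 * localMaxwellian 1 (θ₀ x) (u₀ x) v) =
        fun v => C'⁻¹ * (F (x, v) * ‖v‖ ^ 2 * localMaxwellian 1 (θ₀ x) (u₀ x) v) := by
      funext v; simp only [hF'def]; ring
    rw [e, integral_const_mul, hO3 x, mul_zero]
  -- run the node at tilt `β C'` on the normalised member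
  have hβ' : |β * C'| ≤ β₀ := by
    rw [abs_mul, abs_of_pos hC'0]
    calc |β| * C' ≤ β₀ / C' * C' := mul_le_mul_of_nonneg_right hβ hC'0.le
      _ = β₀ := div_mul_cancel₀ β₀ hC'0.ne'
  obtain ⟨τ₀, hτ₀, Hτ⟩ := Hβ a θ₀ u₀ ha hθ hu ha0 hθm_le hθM_ge huU hguard Φ F' hF'c hF'b hO1' hO2' hO3' (β * C')
    hβ' ε hε
  refine ⟨τ₀, hτ₀, fun τ hτ => ?_⟩
  obtain ⟨N₀, HN⟩ := Hτ τ hτ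
  refine ⟨N₀, fun N hN => ?_⟩
  have h := HN N hN
  refine le_of_eq_of_le (lintegral_congr fun z => ?_) h
  rw [KineticWindowGronwallPlusNode.mul_windowSum (Φ N) F β, KineticWindowGronwallPlusNode.mul_windowSum (Φ N) F' (β * C')]
  congr 2
  refine Finset.sum_congr rfl fun i _ => ?_
  congr 1
  refine intervalIntegral.integral_congr fun r _ => ?_
  simp only [hF'def]
  field_simp

/-- **The v4 registered stubs still close the crux, WITHOUT the coherence child**: child 1 (node) and child 3's item 17691 ∧ 3091, together with
SEET, EAT, CAT, give the crux — `CoherentSuprathermalContentVanishesW`, `TransferActivityTails` (16624) and `EnergyCurrentTails` (9235) are no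
longer consumed. [folklore] -/
theorem kineticWindowGronwall_of_child₁ (hU : KineticWindowGronwallSplit.KineticWindowLDBoundsUniform)
    (hS : OneFlightGossipEngine.SuperExponentialEnergyTails) (hL : OneFlightGossipEngine.LocalClampedTransferLDAlongFamilies)
    (hE : OneFlightGossipEngine.EnergyActivityTails) (hC : OneFlightGossipEngine.CollisionActivityTails) (hD : DiluteSelfConsistency) :
    KineticWindowGronwall :=
  kineticWindowGronwall_of_signedItems' hS (kcwfQ_of_child₁ hU) hL hE hC hD



/-! ## §3 The registered helper stub -/

/-- **Registered helper stub `stub_signedDockGlue`** (crux stmt-AtomisticToContinuum-9282, line `board-node-dock`, skeleton v5): the six board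
items imply the crux (sibling decl) — `kineticWindowGronwall_of_signedItems'` with a one-line fully qualified header (the registered signature).
Route-internal bookkeeping; the `--glue-by` shape of a six-way split of stmt-9282 onto 17701/18052/17691/17703/13734/3091. [folklore] -/
theorem stub_signedDockGlue : Summit.AtomisticToContinuum.HydrodynamicLimit.Theses.OneFlightGossipEngine.SuperExponentialEnergyTails → Summit.AtomisticToContinuum.HydrodynamicLimit.Theses.OneFlightGossipEngine.KineticCurrentsLDAlongFamiliesQ → Summit.AtomisticToContinuum.HydrodynamicLimit.Theses.OneFlightGossipEngine.LocalClampedTransferLDAlongFamilies → Summit.AtomisticToContinuum.HydrodynamicLimit.Theses.OneFlightGossipEngine.EnergyActivityTails → Summit.AtomisticToContinuum.HydrodynamicLimit.Theses.OneFlightGossipEngine.CollisionActivityTails → Summit.AtomisticToContinuum.HydrodynamicLimit.Theses.TwoClocks.DiluteSelfConsistency → Summit.AtomisticToContinuum.HydrodynamicLimit.Theses.AntiMazurCoboundaries.KineticWindowGronwall :=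
  kineticWindowGronwall_of_signedItems'


/-! ## §4 The in-band Yau target needs only five of the six items -/

/-- **The IN-BAND Yau target (FluxGibbsianityLdDrude's re-typed target `RelEntropyVanishingInBand`, stmt-17396) from FIVE items — no
`DiluteSelfConsistency`**: the guarded core from SEET, KCWF-Q, LCTF, EAT, CAT (`gronwallCoreInBand_of_signedItems`) read through the landed in-band
reduction `EntropyClockDock.relEntropyVanishingInBand_of_gronwallCoreInBand` (activity inversion, reference tie, `t = 0` slice, uniform local Gibbs
concentration — all inside). So the un-guarding input DSC (3091) is EXACTLY the difference between the crux's consequent (0766, unguarded) and 17396.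
[cite: Yau1991, §2] -/
theorem relEntropyVanishingInBand_of_signedItems (hS : OneFlightGossipEngine.SuperExponentialEnergyTails)
    (hQ : OneFlightGossipEngine.KineticCurrentsLDAlongFamiliesQ) (hL : OneFlightGossipEngine.LocalClampedTransferLDAlongFamilies)
    (hE : OneFlightGossipEngine.EnergyActivityTails) (hC : OneFlightGossipEngine.CollisionActivityTails) :
    Summit.AtomisticToContinuum.HydrodynamicLimit.Theses.FluxGibbsianityLdDrude.RelEntropyVanishingInBand :=
  EntropyClockDock.relEntropyVanishingInBand_of_gronwallCoreInBand (gronwallCoreInBand_of_signedItems hS hQ hL hE hC)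

/-- **Registered helper stub `stub_inBandOfSignedItems`** (crux stmt-AtomisticToContinuum-9282, line `board-node-dock`, skeleton v5): the five
items imply the in-band Yau target 17396 — `relEntropyVanishingInBand_of_signedItems` with a one-line fully qualified header (the registered
signature). Route-internal bookkeeping. [folklore] -/
theorem stub_inBandOfSignedItems : Summit.AtomisticToContinuum.HydrodynamicLimit.Theses.OneFlightGossipEngine.SuperExponentialEnergyTails → Summit.AtomisticToContinuum.HydrodynamicLimit.Theses.OneFlightGossipEngine.KineticCurrentsLDAlongFamiliesQ → Summit.AtomisticToContinuum.HydrodynamicLimit.Theses.OneFlightGossipEngine.LocalClampedTransferLDAlongFamilies → Summit.AtomisticToContinuum.HydrodynamicLimit.Theses.OneFlightGossipEngine.EnergyActivityTails → Summit.AtomisticToContinuum.HydrodynamicLimit.Theses.OneFlightGossipEngine.CollisionActivityTails → Summit.AtomisticToContinuum.HydrodynamicLimit.Theses.FluxGibbsianityLdDrude.RelEntropyVanishingInBand :=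
  relEntropyVanishingInBand_of_signedItems

end Summit.AtomisticToContinuum.HydrodynamicLimit.Theorems.KineticWindowGronwallSignedDock

end
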